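import Summits.KontsevichZagierPeriods.KontsevichZagierPeriods.Theses.SymplecticScissors
import Summits.KontsevichZagierPeriods.KontsevichZagierPeriods.Theorems.RealOnePeriodRelations.Negative.Kit
import Summits.KontsevichZagierPeriods.KontsevichZagierPeriods.Theorems.SymplecticScissorsRealOnePeriodRelationsStubSaChart
import Summits.KontsevichZagierPeriods.KontsevichZagierPeriods.Theorems.SymplecticScissorsRealOnePeriodRelationsStubSaPathSubset
import Summits.KontsevichZagierPeriods.KontsevichZagierPeriods.Theorems.SymplecticScissorsRealOnePeriodRelationsStubGreenOnSquare
import Summits.KontsevichZagierPeriods.KontsevichZagierPeriods.Theorems.SymplecticScissorsRealOnePeriodRelationsStubCellGreen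
import Summits.KontsevichZagierPeriods.KontsevichZagierPeriods.Theorems.SymplecticScissorsRealOnePeriodRelationsStubHomotopyInvariance
import Summits.KontsevichZagierPeriods.KontsevichZagierPeriods.Theorems.SymplecticScissorsRealOnePeriodRelationsStubSaHomotopic
import Summits.KontsevichZagierPeriods.KontsevichZagierPeriods.Theorems.SymplecticScissorsRealOnePeriodRelationsStubExactDimOne
import Summits.KontsevichZagierPeriods.KontsevichZagierPeriods.Theorems.SymplecticScissorsRealOnePeriodRelationsStubRealises
import Summits.KontsevichZagierPeriods.KontsevichZagierPeriods.Theorems.SymplecticScissorsRealOnePeriodRelationsStubRetraction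
import Summits.KontsevichZagierPeriods.KontsevichZagierPeriods.Theorems.SymplecticScissorsRealOnePeriodRelationsStubNormalisation
import Summits.KontsevichZagierPeriods.KontsevichZagierPeriods.Theorems.SymplecticScissorsRealOnePeriodRelationsConditional
import Literature.NumberTheory.Transcendental.KZCalculus
import Literature.NumberTheory.Transcendental.CurvePeriods
import Literature.NumberTheory.Transcendental.SemialgebraicMaps

/-!
# `RealOnePeriodRelations` from the period conjecture for curve-type periods (line `nash-retraction-thin-strip`)

Sorry-free assembly of the line: every stub of the registered skeleton
`Cruxes/RealOnePeriodRelations/Lines/nash-retraction-thin-strip.lean` except the apex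
`stub_huberWustholz : PeriodConjectureCurveType` (crux `stmt-KontsevichZagierPeriods-14055`, the Huber–Wüstholz
theorem for periods of curve type) is a landed theorem; composing them exactly as in `RealOnePeriodRelations_of`
gives the crux CONDITIONALLY on the apex, i.e. the implication
`PeriodConjectureCurveType → RealOnePeriodRelations` (registered anchor `helper_final_conditional`); the sibling crux
`CurvePeriodsTransfer`, which is this implication by definition, is closed in `Theorems/SymplecticScissorsCurvePeriodsTransfer.lean`.
[cite: HuberWustholz2022, Thm 13.3 (2)] [cite: KontsevichZagier2001, §1.2]

REPAIR 2026-08-16: the items-cap autofix of 2026-08-16T14:16Z DROPPED the route decl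
`Theses.SymplecticScissors.PeriodConjectureCurveType` (item stmt-14055, closed `moot`; likewise `CurvePeriodsTransfer`,
stmt-11129), so the two theorems of this file stopped elaborating ("Unknown identifier" in the full builds). The dropped
decl was, verbatim, the Literature named fact `Literature.NumberTheory.Transcendental.HuberWustholzCurvePeriods`
(`PeriodConjectureCurveType ↔ HuberWustholzCurvePeriods` was `Iff.rfl`), and the composition was re-landed with the SAME
proof against that fact as `realOnePeriodRelations_of_huberWustholzCurvePeriods`
(`Theorems/SymplecticScissorsRealOnePeriodRelationsConditional.lean`). This file (append-only) now imports that module: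
`RealOnePeriodRelations_of_periodConjectureCurveType` survives as a deprecated alias of it, and the registered anchor
`helper_final_conditional` (re-registered on crux stmt-10042 over `HuberWustholzCurvePeriods`) survives as a deprecated
alias of it too, and `periodConjectureCurveType_signature_iff` records that the dropped item was that named fact verbatim.
-/

noncomputable section

open scoped BigOperators unitInterval
open Set MeasureTheory
open Literature.NumberTheory.Transcendental Literature.NumberTheory.Transcendental.CurvePeriods
open Literature.ModelTheory.ExponentialFields (IsSemialgebraic)
open Summit.KontsevichZagierPeriods.SymplecticScissors.RealOnePeriodRelationsNegative (greenSet M₁ H₁ crux_iff)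

namespace Summit.KontsevichZagierPeriods.SymplecticScissors.RealOnePeriodRelations

/-- **Record of the dropped route item `PeriodConjectureCurveType`** = stmt-KontsevichZagierPeriods-14055 (the apex of
this line; dropped from route `SymplecticScissors` by the items-cap autofix of 2026-08-16T14:16Z and closed `moot`): its
ledger signature, verbatim (left), IS the Literature named fact `HuberWustholzCurvePeriods` (Huber–Wüstholz 2022,
Thm 13.3 (2), `Literature/NumberTheory/Transcendental/CurvePeriods.lean`) — definitionally, `Iff.rfl` — so the `moot`
closure retired a duplicate name, not a hypothesis: the line's one open input is that named fact, consumed by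
`realOnePeriodRelations_of_huberWustholzCurvePeriods` / `helper_final_conditional` below. [cite: HuberWustholz2022, Thm 13.3 (2)] -/
theorem periodConjectureCurveType_signature_iff :
    (∀ c : Literature.NumberTheory.Transcendental.CurvePeriods.PeriodSymbol →₀ ℂ, (∀ s, IsAlgebraic ℚ (c s)) → Literature.NumberTheory.Transcendental.CurvePeriods.evalCombination c = 0 → ∃ (k : ℕ) (ρ : Fin k → (Literature.NumberTheory.Transcendental.CurvePeriods.PeriodSymbol →₀ ℂ)) (a : Fin k → ℂ), (∀ l, Literature.NumberTheory.Transcendental.CurvePeriods.IsElementaryRelation (ρ l)) ∧ (∀ l, IsAlgebraic ℚ (a l)) ∧ c = ∑ l, a l • ρ l) ↔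
      Literature.NumberTheory.Transcendental.HuberWustholzCurvePeriods :=
  Iff.rfl

/-- Deprecated spelling of `realOnePeriodRelations_of_huberWustholzCurvePeriods`
(`Theorems/SymplecticScissorsRealOnePeriodRelationsConditional.lean`, same proof: normalise with `stub_normalisation`,
apply the Huber–Wüstholz hypothesis to the resulting curve-type relation, retract with `Θ` via `stub_retraction` and the
coherence stubs): the original took the route decl `Theses.SymplecticScissors.PeriodConjectureCurveType` (stmt-14055) as
hypothesis `hHW`; that decl — verbatim the named fact `HuberWustholzCurvePeriods` — was dropped from the gate-generated
thesis module on 2026-08-16T14:16Z (items-cap autofix), so the hypothesis is now the Literature fact itself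
(definitionally the same statement). [cite: HuberWustholz2022, Thm 13.3 (2)] -/
@[deprecated realOnePeriodRelations_of_huberWustholzCurvePeriods (since := "2026-08-16")]
alias RealOnePeriodRelations_of_periodConjectureCurveType := realOnePeriodRelations_of_huberWustholzCurvePeriods

/-- **Registered anchor `helper_final_conditional`** (crux stmt-KontsevichZagierPeriods-10042, line
`nash-retraction-thin-strip`): the crux `RealOnePeriodRelations` follows from the Huber–Wüstholz theorem for curve-type
periods `HuberWustholzCurvePeriods` alone — every other stub of the line is a landed theorem. Re-stated 2026-08-16 over the
Literature named fact after the route decl `PeriodConjectureCurveType` (stmt-14055, verbatim that fact) was dropped from the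
thesis; superseded by `realOnePeriodRelations_of_huberWustholzCurvePeriods`, of which it is a deprecated alias.
[cite: HuberWustholz2022, Thm 13.3 (2)] -/
@[deprecated realOnePeriodRelations_of_huberWustholzCurvePeriods (since := "2026-08-16")]
alias helper_final_conditional := realOnePeriodRelations_of_huberWustholzCurvePeriods

end Summit.KontsevichZagierPeriods.SymplecticScissors.RealOnePeriodRelations

end
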